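import Mathlib
import HarnessLib

/-!
# Stub `stub_blowDownOfFarField` of the line `Sketch`
# (crux stmt-AnomalousDissipation-17917, `DyadicWallCascade.ViscousContinuation`)

This file proves the registered stub `stub_blowDownOfFarField` of line `Sketch` of the crux
stmt-AnomalousDissipation-17917 (`ViscousContinuation`): far-field uniform convergence + dilation
invariance ⟹ dyadic band blow-down. Precisely: if the steady pair `(W, P)` converges to the
hierarchy `(V, Q)` uniformly as the third coordinate `X 2 → +∞`, and `(V, Q)` is invariant under the
dilation `X ↦ 2 • X` on the upper half-space `{X 2 > 0}`, then the dyadic blow-downs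
`(W, P) (2 ^ m • X)` converge to `(V, Q) X` uniformly on the band `1 ≤ X 2 ≤ 2` as `m → ∞`.

Proof: iterating the dilation invariance gives `(V, Q) (2 ^ m • X) = (V, Q) X` for `X 2 > 0`; on the
band, `(2 ^ m • X) 2 = 2 ^ m * X 2 ≥ 2 ^ m ≥ m`, which exceeds any far-field threshold `Z` once
`m ≥ M ≥ Z` (`exists_nat_ge`). The band's upper bound `X 2 ≤ 2` is not used.
-/

-- `Summit.<Summit>.<Problem>`: single-conjunct summit, the duplicate namespace is mandated (CONVENTIONS §2).
set_option linter.dupNamespace false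

noncomputable section

namespace Summit.AnomalousDissipation.AnomalousDissipation.Theorems

/-- Euclidean 3-space (local notation, as in the registered skeleton). -/
local notation "E³" => EuclideanSpace ℝ (Fin 3)

/-- Third coordinate of a real dilate: `(c • X) 2 = c * X 2`. [folklore] -/
theorem blowDown_smul_apply_two (c : ℝ) (X : E³) : (c • X) 2 = c * X 2 := by
  rw [PiLp.smul_apply, smul_eq_mul]

/-- Iterated dilation invariance: if `(V, Q)` is invariant under `X ↦ 2 • X` on the upper half-space
`{X 2 > 0}`, then it is invariant under `X ↦ 2 ^ m • X` there, for every `m : ℕ`. [folklore] -/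
theorem blowDown_iterate_invariance (V : E³ → E³) (Q : E³ → ℝ)
    (hdil : ∀ X : E³, 0 < X 2 → V ((2 : ℝ) • X) = V X ∧ Q ((2 : ℝ) • X) = Q X) :
    ∀ (m : ℕ) (X : E³), 0 < X 2 → V ((2 : ℝ) ^ m • X) = V X ∧ Q ((2 : ℝ) ^ m • X) = Q X := by
  intro m
  induction m with
  | zero =>
    intro X _
    simp
  | succ n ih =>
    intro X hX
    have hpos : 0 < ((2 : ℝ) ^ n • X) 2 := by
      rw [blowDown_smul_apply_two]
      positivity
    have hstep := hdil ((2 : ℝ) ^ n • X) hpos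
    rw [pow_succ', mul_smul, hstep.1, hstep.2]
    exact ih X hX

/-- The elementary bound `(m : ℝ) ≤ 2 ^ m`. [folklore] -/
theorem blowDown_natCast_le_two_pow (m : ℕ) : (m : ℝ) ≤ (2 : ℝ) ^ m := by
  exact_mod_cast (Nat.lt_two_pow_self (n := m)).le

/-- On the band `1 ≤ X 2`, the dyadic dilate `2 ^ m • X` lies beyond any threshold `Z ≤ m`:
`Z ≤ (2 ^ m • X) 2`. [folklore] -/
theorem blowDown_threshold {Z : ℝ} {m : ℕ} (hm : Z ≤ (m : ℝ)) (X : E³) (hX : 1 ≤ X 2) :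
    Z ≤ ((2 : ℝ) ^ m • X) 2 := by
  rw [blowDown_smul_apply_two]
  calc Z ≤ (m : ℝ) := hm
    _ ≤ (2 : ℝ) ^ m := blowDown_natCast_le_two_pow m
    _ ≤ (2 : ℝ) ^ m * X 2 := le_mul_of_one_le_right (pow_nonneg (by norm_num) m) hX

/-- **Stub `stub_blowDownOfFarField` (line `Sketch`, crux stmt-AnomalousDissipation-17917).**
Far-field uniform convergence of `(W, P)` to a hierarchy `(V, Q)` that is invariant under the dilation
`X ↦ 2 • X` on the upper half-space implies uniform convergence of the dyadic blow-downs
`(W, P) (2 ^ m • X)` to `(V, Q) X` on the band `1 ≤ X 2 ≤ 2`. [folklore] -/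
theorem stub_blowDownOfFarField : ∀ (W V : E³ → E³) (P Q : E³ → ℝ), (∀ X : E³, 0 < X 2 → V ((2 : ℝ) • X) = V X ∧ Q ((2 : ℝ) • X) = Q X) → (∀ ε : ℝ, 0 < ε → ∃ Z : ℝ, ∀ X : E³, Z ≤ X 2 → ‖W X - V X‖ ≤ ε ∧ |P X - Q X| ≤ ε) → ∀ ε : ℝ, 0 < ε → ∃ M : ℕ, ∀ m : ℕ, M ≤ m → ∀ X : E³, 1 ≤ X 2 → X 2 ≤ 2 → ‖W ((2 : ℝ) ^ m • X) - V X‖ ≤ ε ∧ |P ((2 : ℝ) ^ m • X) - Q X| ≤ ε := by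
  intro W V P Q hdil hfar ε hε
  obtain ⟨Z, hZ⟩ := hfar ε hε
  obtain ⟨M, hM⟩ := exists_nat_ge Z
  refine ⟨M, fun m hm X hX1 _hX2 => ?_⟩
  have hXpos : 0 < X 2 := lt_of_lt_of_le one_pos hX1
  have hinv := blowDown_iterate_invariance V Q hdil m X hXpos
  have hMm : Z ≤ (m : ℝ) := hM.trans (by exact_mod_cast hm)
  have h := hZ ((2 : ℝ) ^ m • X) (blowDown_threshold hMm X hX1)
  rw [hinv.1, hinv.2] at h
  exact h

end Summit.AnomalousDissipation.AnomalousDissipation.Theorems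

end
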